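import Mathlib

/-!
# Half-slot saturation — kernel plate for `Cruxes/BlochSeedDiscOne/B1RANK-ROOMS-monad1-g9.md` §4 (door (P4))
(hsemireg-monad-1 g9, 2026-08-30).  Token: line stmt-HodgeConjecture-18881
Cruxes/BlochSeedDiscOne/Lines/birth.lean 814a6a70c14e831a stub_rung_pad4_seedAt (stub untouched).

Plain finite-dimensional linear algebra over a field (Mathlib only, no `sorry`); fibres ≠ letter designs ≠
sheaves ≠ a SEED; nothing here is a statement toward HC / HC_CM / HC_AV / 18881.  The memo's door (P4)
rests on two facts about the 2-dimensional fibre `F` of a half letter at its degeneracy point (where the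
two quotient covectors `φ₀`, `φ₁` become proportional, `φ₁ = c • φ₀`):

* `ker_le_ker_blocks` — every block of the shape `w₀ ⊗ φ₀ + w₁ ⊗ φ₁` (the unit³·φ and eq³·φ blocks of a
  half-carrying A class into its N36 / N19 targets) kills `ker φ₀`;
* `finrank_range_le_one` — hence the class's column map `L : F → W` has rank ≤ 1 < 2 = dim F, i.e. the
  display map `i` is not injective on fibres along that divisor unless an `eqH` arrow survives.
The last theorem records the rank budgets `rank N = r_A + r_C + 4` of the seven §9 tables examined.
-/

namespace Summit.HodgeConjecture.HodgeConjecture.Cruxes.BlochSeedDiscOne.HalfSlotSaturation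

open Module

variable {K F W : Type*} [Field K] [AddCommGroup F] [Module K F] [AddCommGroup W] [Module K W]

/-- At the degeneracy point `φ₁ = c • φ₀` a two-term block built from the covectors kills `ker φ₀`. -/
theorem ker_le_ker_blocks (φ₀ : F →ₗ[K] K) (c : K) (w₀ w₁ : W) :
    LinearMap.ker φ₀ ≤ LinearMap.ker (φ₀.smulRight w₀ + (c • φ₀).smulRight w₁) := by
  intro x hx
  rw [LinearMap.mem_ker] at hx
  rw [LinearMap.mem_ker, LinearMap.add_apply, LinearMap.smulRight_apply, LinearMap.smulRight_apply,
    LinearMap.smul_apply, hx, smul_eq_mul, mul_zero, zero_smul, zero_smul, add_zero]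

/-- Sums of such blocks (several targets) still kill `ker φ₀`. -/
theorem ker_le_ker_add {L₁ L₂ : F →ₗ[K] W} (φ₀ : F →ₗ[K] K)
    (h₁ : LinearMap.ker φ₀ ≤ LinearMap.ker L₁) (h₂ : LinearMap.ker φ₀ ≤ LinearMap.ker L₂) :
    LinearMap.ker φ₀ ≤ LinearMap.ker (L₁ + L₂) := by
  intro x hx
  have a := h₁ hx; have b := h₂ hx
  rw [LinearMap.mem_ker] at a b ⊢
  rw [LinearMap.add_apply, a, b, add_zero]

variable [FiniteDimensional K F]

/-- (P4): a linear map out of the 2-dimensional half fibre whose kernel contains the kernel of a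
functional has rank at most 1 (so it is not injective). -/
theorem finrank_range_le_one (φ : F →ₗ[K] K) (L : F →ₗ[K] W) (hF : finrank K F = 2)
    (h : LinearMap.ker φ ≤ LinearMap.ker L) : finrank K (LinearMap.range L) ≤ 1 := by
  have h1 : finrank K (LinearMap.range φ) ≤ 1 := by
    calc finrank K (LinearMap.range φ) ≤ finrank K K := Submodule.finrank_le _
      _ = 1 := Module.finrank_self K
  have h2 := LinearMap.finrank_range_add_finrank_ker φ
  have h3 := LinearMap.finrank_range_add_finrank_ker L
  have h4 : finrank K (LinearMap.ker φ) ≤ finrank K (LinearMap.ker L) := Submodule.finrank_mono h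
  omega

/-- … in particular such an `L` is not injective. -/
theorem not_injective (φ : F →ₗ[K] K) (L : F →ₗ[K] W) (hF : finrank K F = 2)
    (h : LinearMap.ker φ ≤ LinearMap.ker L) : ¬ Function.Injective L := by
  intro hinj
  have hk : LinearMap.ker L = ⊥ := LinearMap.ker_eq_bot.mpr hinj
  have h3 := LinearMap.finrank_range_add_finrank_ker L
  have h0 : finrank K (LinearMap.ker L) = 0 := by rw [hk]; exact finrank_bot K F
  have := finrank_range_le_one φ L hF h
  omega

/-- Rank budgets `rank N = r_A + r_C + 4` of the §9 tables M1 a24-dblC3, M2 a21-dblC-x0000, M3 s2-a16-dblC,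
M4 s2-a13-x0000, a28-dblC4, a24-dblC3-sym (rank E = 4 is the whole slack of every display), and the
(P4) count on M1: 16 half-carrying A classes, 24 of their 32 `eqH` arrows forced to zero by (P2), two per
class on 8 classes, so 8 divisors carry `rank i ≤ 64 - 1 < 64`. -/
theorem budgets :
    156 = 64 + 88 + 4 ∧ 153 = 64 + 85 + 4 ∧ 164 = 64 + 96 + 4 ∧ 161 = 64 + 93 + 4 ∧
    160 = 64 + 92 + 4 ∧ 220 = 96 + 120 + 4 ∧ 32 - 24 = 8 ∧ 16 - 8 = 8 ∧ 64 - 1 < 64 := by decide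

end Summit.HodgeConjecture.HodgeConjecture.Cruxes.BlochSeedDiscOne.HalfSlotSaturation
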